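import Literature.Analysis.Matrix.TorusGreenGradientCore
import HarnessLib

/-!
# Volume-uniform decay of the gradients of the torus Green's function (anisotropic three-torus), II: the decay theorems

`Literature/Analysis/Matrix/`; the assembly of parts III, VI, VII of the finite-range decomposition with the pseudo-inverse
comparison (`FiniteRangeDecompositionPseudoInverse.lean`, `TorusGreenGradientCore.lean`).  Setting: the abstract anisotropic
discrete three-torus — a finite abelian group `G` with steps `e₀,e₁,e₂` of orders dividing `L₀ = L₁ = L ≤ L₂ = M` which determine
the characters, `|G| ≥ L²M` — and a translation-invariant symmetric `A` with `0 ≤ A ≤ 4`, coercive symbol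
`c₀ Σ_i (2 − 2Re ψ(e_i)) ≤ σ_A(ψ)`, zero row sum (`σ_A(1) = 0`: the kernel of `A` is the constants) and finite range `R` for a
pseudo-distance in which the steps have length `≤ 1`.  Then the Green's function `pinv A` (`ConvolutionOperatorMultiplier.lean`)
obeys, UNIFORMLY IN `L ≤ M`:

* `abs_rowDiffs_pinv_le_spatial` — for a list `l` of `k ≥ 1` steps containing a spatial one (`k + 2 ≤ 2m`):
  `|∇_l pinv A (x,y)| ≤ 2K₃ / max(1, (d(x,y) − k)/(2mR))^{k+1} + 2K₁ / L^{k+1}`;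
* `abs_rowDiffs_frdPiecePow_far_temporal_le`, `abs_rowDiffs_pinv_le_temporal` — for a list of `k ≥ 2` temporal steps
  (`k + 2 ≤ 2m`): `|∇_l pinv A (x,y)| ≤ 2K₃ / max(1, (d(x,y) − k)/(2mR))^{k+1} + 2(K₂ + 2K₁) / L^{k+1}`,

* `abs_rowDiffs_pinv_le_spatial'`, `abs_rowDiffs_pinv_le_temporal'` — the same with the un-weakened far terms
  `2K₁/max(1,(d−k)/(2mR), L)^{k+1}` resp. `2(K₂ + 2K₁)/(L² max(1,(d−k)/(2mR), L)^{k−1})`: for these lists the decay CONTINUES beyond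
  the spatial period;

i.e. `|∇^k G(x,y)| ≲ 1/max(1, min(d(x,y), L))^{k+1}` — the dipole (`k = 1`) / quadrupole (`k = 2`) decay of lattice potential
theory in three dimensions up to the spatial period, beyond which (temporal separations up to `M/2`) the bound saturates at the
one-dimensional value `L^{−(k+1)}`.  (The single temporal difference, where mode-by-mode bounds lose `log(M/L)`, is treated in
`TorusGreenGradientDecayTemporal.lean` by the reflection device of `ConvolutionOperatorReflection.lean`.)
All [folklore]; cf. [cite: Bauerschmidt2013, (1.10)], [cite: BauerschmidtBrydgesSlade2019, §1.5].
-/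

noncomputable section

open Finset Real
open Literature.Analysis.Fourier Literature.Analysis.Fourier.TrigApprox

namespace Literature.Analysis.Matrix

variable {G : Type*} [AddCommGroup G] [Fintype G] [DecidableEq G]

/-! ## The decay theorems -/

section Decay

variable {A : _root_.Matrix G G ℝ}

/-- `(L/2^N)^{2m}/L^{k+1} ≤ 2^{−N(k+1)}` when `L ≤ 2^N` and `k + 1 ≤ 2m`. [folklore] -/
theorem ratio_pow_div_le {Lr T : ℝ} (hL : 0 < Lr) (hLT : Lr ≤ T) {m k : ℕ} (hkm : k + 2 ≤ 2 * m) :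
    (Lr / T) ^ (2 * m) / Lr ^ (k + 1) ≤ ((1 : ℝ) / T) ^ (k + 1) := by
  have hT : 0 < T := hL.trans_le hLT
  have hL0 : Lr ≠ 0 := hL.ne'
  have hT0 : T ≠ 0 := hT.ne'
  obtain ⟨d, hd⟩ : ∃ d, 2 * m = k + 1 + d := ⟨2 * m - (k + 1), by omega⟩
  have hratio : Lr / T ≤ 1 := (div_le_one hT).2 hLT
  have hratio0 : 0 ≤ Lr / T := by positivity
  calc (Lr / T) ^ (2 * m) / Lr ^ (k + 1) = (Lr / T) ^ (k + 1) * (Lr / T) ^ d / Lr ^ (k + 1) := by rw [hd, pow_add]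
    _ ≤ (Lr / T) ^ (k + 1) * 1 / Lr ^ (k + 1) := by
        gcongr
        exact pow_le_one₀ hratio0 hratio
    _ = ((1 : ℝ) / T) ^ (k + 1) := by
        rw [mul_one, div_pow, div_pow, one_pow]
        field_simp

/-- **Decay of the Green's function gradients, lists with a spatial step.**  Under the hypotheses of the header, for a list
`l` of `k ≥ 1` steps among `±e_i` containing one of `±e₀, ±e₁`, with `k + 2 ≤ 2m`, and all `x, y`:
`|∇_l pinv A (x,y)| ≤ 2K₃ / max(1, (d(x,y) − k)/(2mR))^{k+1} + 2K₁ / L^{k+1}`,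
`K₃ = (27m(2π)^k/4)(1 + 2^{k+4}π^{2m+2}/(16c₀)^{m+1})`, `K₁ = 27m(2π)^kπ^{2m+2}2^{k+4}/(4(16c₀)^{m+1})`.
[cite: Bauerschmidt2013, (1.10) (exponents); folklore assembly] -/
theorem abs_rowDiffs_pinv_le_spatial
    (e : Fin 3 → G) (Ls : Fin 3 → ℕ) (hL : ∀ i, Ls i ≠ 0) (he : ∀ i, Ls i • e i = 0)
    (hgen : ∀ ψ φ : AddChar G ℂ, (∀ i, ψ (e i) = φ (e i)) → ψ = φ)
    (hcard : ∏ i, (Ls i : ℝ) ≤ Fintype.card G) (hL01 : Ls 1 = Ls 0) (hLM : Ls 0 ≤ Ls 2)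
    (hA : IsTranslationInvariant A) (hs : A.IsHermitian) (hP : A.PosSemidef)
    (h4 : ((4 : ℝ) • (1 : _root_.Matrix G G ℝ) - A).PosSemidef)
    {c₀ : ℝ} (hc₀ : 0 < c₀)
    (hcoer : ∀ ψ : AddChar G ℂ, c₀ * ∑ i, (2 - 2 * (ψ (e i)).re) ≤ (symbol A ψ).re)
    (h1 : symbol A 1 = 0)
    {d : G → G → ℕ} (htri : ∀ i j k, d i k ≤ d i j + d j k) (hd0 : ∀ i, d i i = 0)
    (hstep : ∀ (i : Fin 3) (x : G), d x (x + e i) ≤ 1 ∧ d x (x - e i) ≤ 1)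
    {R : ℕ} (hR : HasFiniteRange d R A)
    {m : ℕ} (l : List G) (hl : ∀ g ∈ l, ∃ i, g = e i ∨ g = -e i)
    (hspat : ∃ g ∈ l, g = e 0 ∨ g = -e 0 ∨ g = e 1 ∨ g = -e 1) (hkm : l.length + 2 ≤ 2 * m) (x y : G) :
    |rowDiffs l (pinv A) x y|
      ≤ 2 * (27 * m * (2 * π) ^ l.length / 4 * (1 + 2 ^ (l.length + 4) * π ^ (2 * m + 2) / (16 * c₀) ^ (m + 1)))
            * (1 / max 1 (((d x y : ℝ) - l.length) / (2 * m * R))) ^ (l.length + 1)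
        + 2 * (27 * m * (2 * π) ^ l.length * π ^ (2 * m + 2) * 2 ^ (l.length + 4) / (4 * (16 * c₀) ^ (m + 1)))
            * (1 / (Ls 0 : ℝ)) ^ (l.length + 1) := by
  set k := l.length with hk
  have hl1 : l ≠ [] := by obtain ⟨g, hg, -⟩ := hspat; exact List.ne_nil_of_mem hg
  have hm : 1 ≤ m := by omega
  have hLpos : (0 : ℝ) < (Ls 0 : ℝ) := Nat.cast_pos.mpr (Nat.pos_of_ne_zero (hL 0))
  have hL1 : (1 : ℝ) ≤ (Ls 0 : ℝ) := by exact_mod_cast Nat.pos_of_ne_zero (hL 0)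
  have h0 := symbol_eq_zero_iff_eq_one e Ls hL he hgen hL01 hLM hc₀ hcoer h1
  have hMpos : (0 : ℝ) < (Ls 2 : ℝ) := Nat.cast_pos.mpr (Nat.pos_of_ne_zero (hL 2))
  have ha₀ : (0 : ℝ) < 16 * c₀ / (Ls 2 : ℝ) ^ 2 := by positivity
  have hmin := symbol_re_ge_of_ne_one e Ls hL he hgen hL01 hLM hc₀ hcoer
  -- steps have length `≤ 1`
  have hl_len : ∀ g ∈ l, ∀ z, d z (z + g) ≤ 1 := by
    intro g hg z
    obtain ⟨i, rfl | rfl⟩ := hl g hg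
    · exact (hstep i z).1
    · rw [← sub_eq_add_neg]; exact (hstep i z).2
  -- (0) vanishing below the scale of the separation
  have hvan : ∀ N : ℕ, (2 : ℝ) ^ N < ((d x y : ℝ) - k) / (2 * m * R) → rowDiffs l (frdPiecePow A m N) x y = 0 := by
    intro N hN
    refine rowDiffs_apply_eq_zero_of_lt_dist htri (hasFiniteRange_frdPiecePow htri hd0 hR m N) hl_len ?_
    -- `2^N < (D − k)/(2mR)` forces `R ≠ 0`... or `D − k > 0`; in all cases `2m2^N R + k < D`
    by_contra hcon
    push Not at hcon
    have hmR : (0 : ℝ) ≤ 2 * m * R := by positivity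
    rcases hmR.eq_or_lt with hzero | hposR
    · rw [← hzero, div_zero] at hN
      exact absurd hN (not_lt.2 (by positivity))
    · rw [lt_div_iff₀ hposR] at hN
      have : ((2 * m * 2 ^ N * R + k : ℕ) : ℝ) ≥ (d x y : ℝ) := by exact_mod_cast hcon
      push_cast at this
      nlinarith
  -- (1) the three-dimensional scales
  have h3D : ∀ N : ℕ, (2 : ℝ) ^ N ≤ (Ls 0 : ℝ) → |rowDiffs l (frdPiecePow A m N) x y|
      ≤ (27 * m * (2 * π) ^ k / 4 * (1 + 2 ^ (k + 4) * π ^ (2 * m + 2) / (16 * c₀) ^ (m + 1)))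
          * ((1 : ℝ) / 2 ^ N) ^ (k + 1) := by
    intro N hN
    have hN' : (2 ^ N : ℕ) ≤ Ls 0 := by exact_mod_cast hN
    have hLN : ∀ i, 2 ^ N ≤ Ls i := by
      intro i; fin_cases i
      · exact hN'
      · simp only [Fin.mk_one]; rw [hL01]; exact hN'
      · exact hN'.trans hLM
    have h := abs_rowDiffs_frdPiecePow_apply_le_inv_pow e Ls he hgen hcard hA hs hP h4 hc₀ hcoer m N hLN l hl hkm x y
    rwa [one_div_pow, ← div_eq_mul_one_div] at *
  -- (2) the scales beyond `L`: spatial-step bound at every scale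
  have hfar : ∀ N : ℕ, (Ls 0 : ℝ) < (2 : ℝ) ^ N → |rowDiffs l (frdPiecePow A m N) x y|
      ≤ (27 * m * (2 * π) ^ k * π ^ (2 * m + 2) * 2 ^ (k + 4) / (4 * (16 * c₀) ^ (m + 1)))
          * ((1 : ℝ) / 2 ^ N) ^ (k + 1) * 1 := by
    intro N hN
    have h := abs_rowDiffs_frdPiecePow_apply_le_offL_spatial e Ls hL he hgen hcard hL01 hLM hA hs hP h4 hc₀ hcoer m N l
      hl hspat hkm x y
    refine h.trans ?_
    rw [mul_one, mul_div_assoc]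
    exact mul_le_mul_of_nonneg_left (ratio_pow_div_le hLpos hN.le hkm) (by positivity)
  have hcore := abs_rowDiffs_pinv_le_core hA hs hP h4 h0 ha₀ hmin hm hl1 x y (by positivity) (by positivity)
    zero_le_one (by omega : 1 ≤ k + 1) (by omega : 1 ≤ k + 1) hvan h3D hfar
  rw [mul_one] at hcore
  refine hcore.trans (add_le_add le_rfl ?_)
  refine mul_le_mul_of_nonneg_left (pow_le_pow_left₀ (by positivity) ?_ _) (by positivity)
  exact one_div_le_one_div_of_le hLpos ((le_max_right _ _).trans (le_max_right _ _))

/-- **The scales beyond `L` for temporal lists of length `k ≥ 2`**: a common majorant of the quasi-one-dimensional and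
beyond-the-period piece bounds, `|∇_l C^{(m)}_N (x,y)| ≤ (K₂ + 2K₁)·2^{−N(k−1)}/L²` for `2^N > L`. [folklore] -/
theorem abs_rowDiffs_frdPiecePow_far_temporal_le
    (e : Fin 3 → G) (Ls : Fin 3 → ℕ) (hL : ∀ i, Ls i ≠ 0) (he : ∀ i, Ls i • e i = 0)
    (hgen : ∀ ψ φ : AddChar G ℂ, (∀ i, ψ (e i) = φ (e i)) → ψ = φ)
    (hcard : ∏ i, (Ls i : ℝ) ≤ Fintype.card G) (hL01 : Ls 1 = Ls 0) (hLM : Ls 0 ≤ Ls 2)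
    (hA : IsTranslationInvariant A) (hs : A.IsHermitian) (hP : A.PosSemidef)
    (h4 : ((4 : ℝ) • (1 : _root_.Matrix G G ℝ) - A).PosSemidef)
    {c₀ : ℝ} (hc₀ : 0 < c₀)
    (hcoer : ∀ ψ : AddChar G ℂ, c₀ * ∑ i, (2 - 2 * (ψ (e i)).re) ≤ (symbol A ψ).re)
    {m : ℕ} (N : ℕ) (hN : (Ls 0 : ℝ) < (2 : ℝ) ^ N)
    (l : List G) (htemp : ∀ g ∈ l, g = e 2 ∨ g = -e 2) (hk2 : 2 ≤ l.length) (hkm : l.length + 2 ≤ 2 * m) (x y : G) :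
    |rowDiffs l (frdPiecePow A m N) x y|
      ≤ (27 * m * (2 * π) ^ l.length / 4 * (1 + 5 * 2 ^ (l.length + 2) * π ^ (2 * m + 2) / (16 * c₀) ^ (m + 1))
          + 2 * (27 * m * (2 * π) ^ l.length * π ^ (2 * m + 2) * 2 ^ (l.length + 4) / (4 * (16 * c₀) ^ (m + 1))))
        * ((1 : ℝ) / 2 ^ N) ^ (l.length - 1) * (1 / (Ls 0 : ℝ) ^ 2) := by
  set k := l.length with hk
  have hl1 : l ≠ [] := List.ne_nil_of_length_pos (by omega)
  have hLpos : (0 : ℝ) < (Ls 0 : ℝ) := Nat.cast_pos.mpr (Nat.pos_of_ne_zero (hL 0))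
  have hMpos : (0 : ℝ) < (Ls 2 : ℝ) := Nat.cast_pos.mpr (Nat.pos_of_ne_zero (hL 2))
  set K₁ : ℝ := 27 * m * (2 * π) ^ k * π ^ (2 * m + 2) * 2 ^ (k + 4) / (4 * (16 * c₀) ^ (m + 1)) with hK₁
  set K₂ : ℝ := 27 * m * (2 * π) ^ k / 4 * (1 + 5 * 2 ^ (k + 2) * π ^ (2 * m + 2) / (16 * c₀) ^ (m + 1)) with hK₂
  have hK₁0 : 0 ≤ K₁ := by rw [hK₁]; positivity
  have hK₂0 : 0 ≤ K₂ := by rw [hK₂]; positivity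
  have hTpos : (0 : ℝ) < (2 : ℝ) ^ N := by positivity
  obtain ⟨k', hk'⟩ : ∃ k', k = k' + 2 := ⟨k - 2, by omega⟩
  have hpow : ((1 : ℝ) / 2 ^ N) ^ (k - 1) = ((1 : ℝ) / 2 ^ N) ^ (k' + 1) := by
    rw [hk', show k' + 2 - 1 = k' + 1 by omega]
  by_cases hM : 2 ^ N < Ls 2
  · -- quasi-one-dimensional regime
    have hLT : Ls 0 ≤ 2 ^ N := by exact_mod_cast hN.le
    have h := abs_rowDiffs_frdPiecePow_apply_le_quasi1D_temporal e Ls hL he hgen hcard hL01 hA hs hP h4 hc₀ hcoer m N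
      hLT hM.le l htemp hkm x y
    refine h.trans ?_
    rw [← hK₂, hpow]
    have e1 : K₂ * (2 : ℝ) ^ N / (((2 : ℝ) ^ N) ^ k * (Ls 0 : ℝ) ^ 2)
        = K₂ * ((1 : ℝ) / 2 ^ N) ^ (k' + 1) * (1 / (Ls 0 : ℝ) ^ 2) := by
      rw [hk', one_div_pow]
      field_simp
      ring
    rw [e1]
    have : K₂ ≤ K₂ + 2 * K₁ := by linarith
    gcongr
  · -- beyond the temporal period
    push Not at hM
    have h := abs_rowDiffs_frdPiecePow_apply_le_beyond_temporal e Ls hL he hgen hcard hL01 hLM hA hs hP h4 hc₀ hcoer m N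
      hM l hl1 htemp hkm x y
    refine h.trans ?_
    rw [← hK₁, hpow]
    have hM' : (Ls 2 : ℝ) ≤ (2 : ℝ) ^ N := by exact_mod_cast hM
    have t1 : ((Ls 0 : ℝ) / 2 ^ N) ^ (2 * m) / (Ls 0 : ℝ) ^ (k + 1) ≤ ((1 : ℝ) / 2 ^ N) ^ (k' + 1) * (1 / (Ls 0 : ℝ) ^ 2) := by
      refine (ratio_pow_div_le hLpos hN.le hkm).trans ?_
      rw [hk', show k' + 2 + 1 = (k' + 1) + 2 by ring, pow_add]
      refine mul_le_mul_of_nonneg_left ?_ (by positivity)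
      rw [one_div_pow]
      exact one_div_le_one_div_of_le (by positivity) (pow_le_pow_left₀ hLpos.le hN.le 2)
    have t2 : (Ls 2 : ℝ) ^ 2 / (((2 : ℝ) ^ N) ^ (k + 1) * (Ls 0 : ℝ) ^ 2) ≤ ((1 : ℝ) / 2 ^ N) ^ (k' + 1) * (1 / (Ls 0 : ℝ) ^ 2) := by
      rw [hk', show k' + 2 + 1 = (k' + 1) + 2 by ring, pow_add, one_div_pow, div_le_iff₀ (by positivity)]
      have hM2 : (Ls 2 : ℝ) ^ 2 ≤ ((2 : ℝ) ^ N) ^ 2 := pow_le_pow_left₀ hMpos.le hM' 2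
      have : 1 / ((2 : ℝ) ^ N) ^ (k' + 1) * (1 / (Ls 0 : ℝ) ^ 2) * (((2 : ℝ) ^ N) ^ (k' + 1) * ((2 : ℝ) ^ N) ^ 2 * (Ls 0 : ℝ) ^ 2)
          = ((2 : ℝ) ^ N) ^ 2 := by field_simp
      rw [this]; exact hM2
    calc K₁ * (((Ls 0 : ℝ) / 2 ^ N) ^ (2 * m) / (Ls 0 : ℝ) ^ (k + 1)
            + (Ls 2 : ℝ) ^ 2 / (((2 : ℝ) ^ N) ^ (k + 1) * (Ls 0 : ℝ) ^ 2))
        ≤ K₁ * (((1 : ℝ) / 2 ^ N) ^ (k' + 1) * (1 / (Ls 0 : ℝ) ^ 2) + ((1 : ℝ) / 2 ^ N) ^ (k' + 1) * (1 / (Ls 0 : ℝ) ^ 2)) :=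
          mul_le_mul_of_nonneg_left (add_le_add t1 t2) hK₁0
      _ = 2 * K₁ * ((1 : ℝ) / 2 ^ N) ^ (k' + 1) * (1 / (Ls 0 : ℝ) ^ 2) := by ring
      _ ≤ (K₂ + 2 * K₁) * ((1 : ℝ) / 2 ^ N) ^ (k' + 1) * (1 / (Ls 0 : ℝ) ^ 2) := by
          have : 2 * K₁ ≤ K₂ + 2 * K₁ := by linarith
          gcongr

/-- **Decay of the Green's function gradients, purely temporal lists of length `≥ 2`.**  Under the hypotheses of the header,
for a list `l` of `k ≥ 2` steps among `±e₂` with `k + 2 ≤ 2m`, and all `x, y`: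
`|∇_l pinv A (x,y)| ≤ 2K₃ / max(1, (d(x,y) − k)/(2mR))^{k+1} + 2(K₂ + 2K₁) / L^{k+1}`,
`K₂ = (27m(2π)^k/4)(1 + 5·2^{k+2}π^{2m+2}/(16c₀)^{m+1})`. [cite: Bauerschmidt2013, (1.10) (exponents); folklore assembly] -/
theorem abs_rowDiffs_pinv_le_temporal
    (e : Fin 3 → G) (Ls : Fin 3 → ℕ) (hL : ∀ i, Ls i ≠ 0) (he : ∀ i, Ls i • e i = 0)
    (hgen : ∀ ψ φ : AddChar G ℂ, (∀ i, ψ (e i) = φ (e i)) → ψ = φ)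
    (hcard : ∏ i, (Ls i : ℝ) ≤ Fintype.card G) (hL01 : Ls 1 = Ls 0) (hLM : Ls 0 ≤ Ls 2)
    (hA : IsTranslationInvariant A) (hs : A.IsHermitian) (hP : A.PosSemidef)
    (h4 : ((4 : ℝ) • (1 : _root_.Matrix G G ℝ) - A).PosSemidef)
    {c₀ : ℝ} (hc₀ : 0 < c₀)
    (hcoer : ∀ ψ : AddChar G ℂ, c₀ * ∑ i, (2 - 2 * (ψ (e i)).re) ≤ (symbol A ψ).re)
    (h1 : symbol A 1 = 0)
    {d : G → G → ℕ} (htri : ∀ i j k, d i k ≤ d i j + d j k) (hd0 : ∀ i, d i i = 0)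
    (hstep : ∀ (i : Fin 3) (x : G), d x (x + e i) ≤ 1 ∧ d x (x - e i) ≤ 1)
    {R : ℕ} (hR : HasFiniteRange d R A)
    {m : ℕ} (l : List G) (htemp : ∀ g ∈ l, g = e 2 ∨ g = -e 2) (hk2 : 2 ≤ l.length) (hkm : l.length + 2 ≤ 2 * m)
    (x y : G) :
    |rowDiffs l (pinv A) x y|
      ≤ 2 * (27 * m * (2 * π) ^ l.length / 4 * (1 + 2 ^ (l.length + 4) * π ^ (2 * m + 2) / (16 * c₀) ^ (m + 1)))
            * (1 / max 1 (((d x y : ℝ) - l.length) / (2 * m * R))) ^ (l.length + 1)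
        + 2 * (27 * m * (2 * π) ^ l.length / 4 * (1 + 5 * 2 ^ (l.length + 2) * π ^ (2 * m + 2) / (16 * c₀) ^ (m + 1))
              + 2 * (27 * m * (2 * π) ^ l.length * π ^ (2 * m + 2) * 2 ^ (l.length + 4) / (4 * (16 * c₀) ^ (m + 1))))
            * (1 / (Ls 0 : ℝ)) ^ (l.length - 1) * (1 / (Ls 0 : ℝ) ^ 2) := by
  set k := l.length with hk
  have hl1 : l ≠ [] := List.ne_nil_of_length_pos (by omega)
  have hm : 1 ≤ m := by omega
  have hl : ∀ g ∈ l, ∃ i, g = e i ∨ g = -e i := fun g hg => ⟨2, htemp g hg⟩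
  have hLpos : (0 : ℝ) < (Ls 0 : ℝ) := Nat.cast_pos.mpr (Nat.pos_of_ne_zero (hL 0))
  have hL1 : (1 : ℝ) ≤ (Ls 0 : ℝ) := by exact_mod_cast Nat.pos_of_ne_zero (hL 0)
  have h0 := symbol_eq_zero_iff_eq_one e Ls hL he hgen hL01 hLM hc₀ hcoer h1
  have hMpos : (0 : ℝ) < (Ls 2 : ℝ) := Nat.cast_pos.mpr (Nat.pos_of_ne_zero (hL 2))
  have ha₀ : (0 : ℝ) < 16 * c₀ / (Ls 2 : ℝ) ^ 2 := by positivity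
  have hmin := symbol_re_ge_of_ne_one e Ls hL he hgen hL01 hLM hc₀ hcoer
  have hl_len : ∀ g ∈ l, ∀ z, d z (z + g) ≤ 1 := by
    intro g hg z
    rcases htemp g hg with rfl | rfl
    · exact (hstep 2 z).1
    · rw [← sub_eq_add_neg]; exact (hstep 2 z).2
  have hvan : ∀ N : ℕ, (2 : ℝ) ^ N < ((d x y : ℝ) - k) / (2 * m * R) → rowDiffs l (frdPiecePow A m N) x y = 0 := by
    intro N hN
    refine rowDiffs_apply_eq_zero_of_lt_dist htri (hasFiniteRange_frdPiecePow htri hd0 hR m N) hl_len ?_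
    by_contra hcon
    push Not at hcon
    have hmR : (0 : ℝ) ≤ 2 * m * R := by positivity
    rcases hmR.eq_or_lt with hzero | hposR
    · rw [← hzero, div_zero] at hN
      exact absurd hN (not_lt.2 (by positivity))
    · rw [lt_div_iff₀ hposR] at hN
      have : ((2 * m * 2 ^ N * R + k : ℕ) : ℝ) ≥ (d x y : ℝ) := by exact_mod_cast hcon
      push_cast at this
      nlinarith
  have h3D : ∀ N : ℕ, (2 : ℝ) ^ N ≤ (Ls 0 : ℝ) → |rowDiffs l (frdPiecePow A m N) x y|
      ≤ (27 * m * (2 * π) ^ k / 4 * (1 + 2 ^ (k + 4) * π ^ (2 * m + 2) / (16 * c₀) ^ (m + 1)))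
          * ((1 : ℝ) / 2 ^ N) ^ (k + 1) := by
    intro N hN
    have hN' : (2 ^ N : ℕ) ≤ Ls 0 := by exact_mod_cast hN
    have hLN : ∀ i, 2 ^ N ≤ Ls i := by
      intro i; fin_cases i
      · exact hN'
      · simp only [Fin.mk_one]; rw [hL01]; exact hN'
      · exact hN'.trans hLM
    have h := abs_rowDiffs_frdPiecePow_apply_le_inv_pow e Ls he hgen hcard hA hs hP h4 hc₀ hcoer m N hLN l hl hkm x y
    rwa [one_div_pow, ← div_eq_mul_one_div] at *
  have hfar := fun (N : ℕ) (hN : (Ls 0 : ℝ) < (2 : ℝ) ^ N) =>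
    abs_rowDiffs_frdPiecePow_far_temporal_le e Ls hL he hgen hcard hL01 hLM hA hs hP h4 hc₀ hcoer N hN l htemp hk2 hkm x y
  have hcore := abs_rowDiffs_pinv_le_core hA hs hP h4 h0 ha₀ hmin hm hl1 x y (by positivity) (by positivity)
    (by positivity : (0 : ℝ) ≤ 1 / (Ls 0 : ℝ) ^ 2) (by omega : 1 ≤ k - 1) (by omega : 1 ≤ k + 1) hvan h3D hfar
  refine hcore.trans (add_le_add le_rfl ?_)
  refine mul_le_mul_of_nonneg_right (mul_le_mul_of_nonneg_left (pow_le_pow_left₀ (by positivity) ?_ _) (by positivity))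
    (by positivity)
  exact one_div_le_one_div_of_le hLpos ((le_max_right _ _).trans (le_max_right _ _))


/-! ## Sharper far terms: the decay continues beyond the spatial period for these lists

The core assembly bounds the contribution of the scales above `L` by `2K_f · max(1, θ, L)^{−p} · E` with
`θ = (d(x,y) − k)/(2mR)`; the theorems above weakened this to `L^{−p}`.  The un-weakened forms: -/

/-- **Decay beyond the spatial period, lists with a spatial step**: as `abs_rowDiffs_pinv_le_spatial` with the far term
`2K₁ / max(1, (d(x,y) − k)/(2mR), L)^{k+1}` — for separations `d ≫ L` (temporal) the bound keeps decaying like `d^{−(k+1)}`.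
[folklore] -/
theorem abs_rowDiffs_pinv_le_spatial'
    (e : Fin 3 → G) (Ls : Fin 3 → ℕ) (hL : ∀ i, Ls i ≠ 0) (he : ∀ i, Ls i • e i = 0)
    (hgen : ∀ ψ φ : AddChar G ℂ, (∀ i, ψ (e i) = φ (e i)) → ψ = φ)
    (hcard : ∏ i, (Ls i : ℝ) ≤ Fintype.card G) (hL01 : Ls 1 = Ls 0) (hLM : Ls 0 ≤ Ls 2)
    (hA : IsTranslationInvariant A) (hs : A.IsHermitian) (hP : A.PosSemidef)
    (h4 : ((4 : ℝ) • (1 : _root_.Matrix G G ℝ) - A).PosSemidef)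
    {c₀ : ℝ} (hc₀ : 0 < c₀)
    (hcoer : ∀ ψ : AddChar G ℂ, c₀ * ∑ i, (2 - 2 * (ψ (e i)).re) ≤ (symbol A ψ).re)
    (h1 : symbol A 1 = 0)
    {d : G → G → ℕ} (htri : ∀ i j k, d i k ≤ d i j + d j k) (hd0 : ∀ i, d i i = 0)
    (hstep : ∀ (i : Fin 3) (x : G), d x (x + e i) ≤ 1 ∧ d x (x - e i) ≤ 1)
    {R : ℕ} (hR : HasFiniteRange d R A)
    {m : ℕ} (l : List G) (hl : ∀ g ∈ l, ∃ i, g = e i ∨ g = -e i)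
    (hspat : ∃ g ∈ l, g = e 0 ∨ g = -e 0 ∨ g = e 1 ∨ g = -e 1) (hkm : l.length + 2 ≤ 2 * m) (x y : G) :
    |rowDiffs l (pinv A) x y|
      ≤ 2 * (27 * m * (2 * π) ^ l.length / 4 * (1 + 2 ^ (l.length + 4) * π ^ (2 * m + 2) / (16 * c₀) ^ (m + 1)))
            * (1 / max 1 (((d x y : ℝ) - l.length) / (2 * m * R))) ^ (l.length + 1)
        + 2 * (27 * m * (2 * π) ^ l.length * π ^ (2 * m + 2) * 2 ^ (l.length + 4) / (4 * (16 * c₀) ^ (m + 1)))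
            * (1 / max 1 (max (((d x y : ℝ) - l.length) / (2 * m * R)) (Ls 0 : ℝ))) ^ (l.length + 1) := by
  set k := l.length with hk
  have hl1 : l ≠ [] := by obtain ⟨g, hg, -⟩ := hspat; exact List.ne_nil_of_mem hg
  have hm : 1 ≤ m := by omega
  have hLpos : (0 : ℝ) < (Ls 0 : ℝ) := Nat.cast_pos.mpr (Nat.pos_of_ne_zero (hL 0))
  have h0 := symbol_eq_zero_iff_eq_one e Ls hL he hgen hL01 hLM hc₀ hcoer h1
  have hMpos : (0 : ℝ) < (Ls 2 : ℝ) := Nat.cast_pos.mpr (Nat.pos_of_ne_zero (hL 2))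
  have ha₀ : (0 : ℝ) < 16 * c₀ / (Ls 2 : ℝ) ^ 2 := by positivity
  have hmin := symbol_re_ge_of_ne_one e Ls hL he hgen hL01 hLM hc₀ hcoer
  have hl_len : ∀ g ∈ l, ∀ z, d z (z + g) ≤ 1 := by
    intro g hg z
    obtain ⟨i, rfl | rfl⟩ := hl g hg
    · exact (hstep i z).1
    · rw [← sub_eq_add_neg]; exact (hstep i z).2
  have hvan : ∀ N : ℕ, (2 : ℝ) ^ N < ((d x y : ℝ) - k) / (2 * m * R) → rowDiffs l (frdPiecePow A m N) x y = 0 := by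
    intro N hN
    refine rowDiffs_apply_eq_zero_of_lt_dist htri (hasFiniteRange_frdPiecePow htri hd0 hR m N) hl_len ?_
    by_contra hcon
    push Not at hcon
    have hmR : (0 : ℝ) ≤ 2 * m * R := by positivity
    rcases hmR.eq_or_lt with hzero | hposR
    · rw [← hzero, div_zero] at hN
      exact absurd hN (not_lt.2 (by positivity))
    · rw [lt_div_iff₀ hposR] at hN
      have : ((2 * m * 2 ^ N * R + k : ℕ) : ℝ) ≥ (d x y : ℝ) := by exact_mod_cast hcon
      push_cast at this
      nlinarith
  have h3D : ∀ N : ℕ, (2 : ℝ) ^ N ≤ (Ls 0 : ℝ) → |rowDiffs l (frdPiecePow A m N) x y|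
      ≤ (27 * m * (2 * π) ^ k / 4 * (1 + 2 ^ (k + 4) * π ^ (2 * m + 2) / (16 * c₀) ^ (m + 1)))
          * ((1 : ℝ) / 2 ^ N) ^ (k + 1) := by
    intro N hN
    have hN' : (2 ^ N : ℕ) ≤ Ls 0 := by exact_mod_cast hN
    have hLN : ∀ i, 2 ^ N ≤ Ls i := by
      intro i; fin_cases i
      · exact hN'
      · simp only [Fin.mk_one]; rw [hL01]; exact hN'
      · exact hN'.trans hLM
    have h := abs_rowDiffs_frdPiecePow_apply_le_inv_pow e Ls he hgen hcard hA hs hP h4 hc₀ hcoer m N hLN l hl hkm x y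
    rwa [one_div_pow, ← div_eq_mul_one_div] at *
  have hfar : ∀ N : ℕ, (Ls 0 : ℝ) < (2 : ℝ) ^ N → |rowDiffs l (frdPiecePow A m N) x y|
      ≤ (27 * m * (2 * π) ^ k * π ^ (2 * m + 2) * 2 ^ (k + 4) / (4 * (16 * c₀) ^ (m + 1)))
          * ((1 : ℝ) / 2 ^ N) ^ (k + 1) * 1 := by
    intro N hN
    have h := abs_rowDiffs_frdPiecePow_apply_le_offL_spatial e Ls hL he hgen hcard hL01 hLM hA hs hP h4 hc₀ hcoer m N l
      hl hspat hkm x y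
    refine h.trans ?_
    rw [mul_one, mul_div_assoc]
    exact mul_le_mul_of_nonneg_left (ratio_pow_div_le hLpos hN.le hkm) (by positivity)
  have hcore := abs_rowDiffs_pinv_le_core hA hs hP h4 h0 ha₀ hmin hm hl1 x y (by positivity) (by positivity)
    zero_le_one (by omega : 1 ≤ k + 1) (by omega : 1 ≤ k + 1) hvan h3D hfar
  rw [mul_one] at hcore
  exact hcore

/-- **Decay beyond the spatial period, temporal lists of length `k ≥ 2`**: as `abs_rowDiffs_pinv_le_temporal` with the far term
`2(K₂ + 2K₁) / (L² · max(1, (d(x,y) − k)/(2mR), L)^{k−1})` — e.g. `k = 2`: `O(1/(L² d))` for temporal separations `d ≫ L`, the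
one-dimensional behaviour of the second temporal derivative of the Green's function. [folklore] -/
theorem abs_rowDiffs_pinv_le_temporal'
    (e : Fin 3 → G) (Ls : Fin 3 → ℕ) (hL : ∀ i, Ls i ≠ 0) (he : ∀ i, Ls i • e i = 0)
    (hgen : ∀ ψ φ : AddChar G ℂ, (∀ i, ψ (e i) = φ (e i)) → ψ = φ)
    (hcard : ∏ i, (Ls i : ℝ) ≤ Fintype.card G) (hL01 : Ls 1 = Ls 0) (hLM : Ls 0 ≤ Ls 2)
    (hA : IsTranslationInvariant A) (hs : A.IsHermitian) (hP : A.PosSemidef)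
    (h4 : ((4 : ℝ) • (1 : _root_.Matrix G G ℝ) - A).PosSemidef)
    {c₀ : ℝ} (hc₀ : 0 < c₀)
    (hcoer : ∀ ψ : AddChar G ℂ, c₀ * ∑ i, (2 - 2 * (ψ (e i)).re) ≤ (symbol A ψ).re)
    (h1 : symbol A 1 = 0)
    {d : G → G → ℕ} (htri : ∀ i j k, d i k ≤ d i j + d j k) (hd0 : ∀ i, d i i = 0)
    (hstep : ∀ (i : Fin 3) (x : G), d x (x + e i) ≤ 1 ∧ d x (x - e i) ≤ 1)
    {R : ℕ} (hR : HasFiniteRange d R A)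
    {m : ℕ} (l : List G) (htemp : ∀ g ∈ l, g = e 2 ∨ g = -e 2) (hk2 : 2 ≤ l.length) (hkm : l.length + 2 ≤ 2 * m)
    (x y : G) :
    |rowDiffs l (pinv A) x y|
      ≤ 2 * (27 * m * (2 * π) ^ l.length / 4 * (1 + 2 ^ (l.length + 4) * π ^ (2 * m + 2) / (16 * c₀) ^ (m + 1)))
            * (1 / max 1 (((d x y : ℝ) - l.length) / (2 * m * R))) ^ (l.length + 1)
        + 2 * (27 * m * (2 * π) ^ l.length / 4 * (1 + 5 * 2 ^ (l.length + 2) * π ^ (2 * m + 2) / (16 * c₀) ^ (m + 1))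
              + 2 * (27 * m * (2 * π) ^ l.length * π ^ (2 * m + 2) * 2 ^ (l.length + 4) / (4 * (16 * c₀) ^ (m + 1))))
            * (1 / max 1 (max (((d x y : ℝ) - l.length) / (2 * m * R)) (Ls 0 : ℝ))) ^ (l.length - 1)
            * (1 / (Ls 0 : ℝ) ^ 2) := by
  set k := l.length with hk
  have hl1 : l ≠ [] := List.ne_nil_of_length_pos (by omega)
  have hm : 1 ≤ m := by omega
  have hl : ∀ g ∈ l, ∃ i, g = e i ∨ g = -e i := fun g hg => ⟨2, htemp g hg⟩
  have hLpos : (0 : ℝ) < (Ls 0 : ℝ) := Nat.cast_pos.mpr (Nat.pos_of_ne_zero (hL 0))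
  have h0 := symbol_eq_zero_iff_eq_one e Ls hL he hgen hL01 hLM hc₀ hcoer h1
  have hMpos : (0 : ℝ) < (Ls 2 : ℝ) := Nat.cast_pos.mpr (Nat.pos_of_ne_zero (hL 2))
  have ha₀ : (0 : ℝ) < 16 * c₀ / (Ls 2 : ℝ) ^ 2 := by positivity
  have hmin := symbol_re_ge_of_ne_one e Ls hL he hgen hL01 hLM hc₀ hcoer
  have hl_len : ∀ g ∈ l, ∀ z, d z (z + g) ≤ 1 := by
    intro g hg z
    rcases htemp g hg with rfl | rfl
    · exact (hstep 2 z).1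
    · rw [← sub_eq_add_neg]; exact (hstep 2 z).2
  have hvan : ∀ N : ℕ, (2 : ℝ) ^ N < ((d x y : ℝ) - k) / (2 * m * R) → rowDiffs l (frdPiecePow A m N) x y = 0 := by
    intro N hN
    refine rowDiffs_apply_eq_zero_of_lt_dist htri (hasFiniteRange_frdPiecePow htri hd0 hR m N) hl_len ?_
    by_contra hcon
    push Not at hcon
    have hmR : (0 : ℝ) ≤ 2 * m * R := by positivity
    rcases hmR.eq_or_lt with hzero | hposR
    · rw [← hzero, div_zero] at hN
      exact absurd hN (not_lt.2 (by positivity))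
    · rw [lt_div_iff₀ hposR] at hN
      have : ((2 * m * 2 ^ N * R + k : ℕ) : ℝ) ≥ (d x y : ℝ) := by exact_mod_cast hcon
      push_cast at this
      nlinarith
  have h3D : ∀ N : ℕ, (2 : ℝ) ^ N ≤ (Ls 0 : ℝ) → |rowDiffs l (frdPiecePow A m N) x y|
      ≤ (27 * m * (2 * π) ^ k / 4 * (1 + 2 ^ (k + 4) * π ^ (2 * m + 2) / (16 * c₀) ^ (m + 1)))
          * ((1 : ℝ) / 2 ^ N) ^ (k + 1) := by
    intro N hN
    have hN' : (2 ^ N : ℕ) ≤ Ls 0 := by exact_mod_cast hN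
    have hLN : ∀ i, 2 ^ N ≤ Ls i := by
      intro i; fin_cases i
      · exact hN'
      · simp only [Fin.mk_one]; rw [hL01]; exact hN'
      · exact hN'.trans hLM
    have h := abs_rowDiffs_frdPiecePow_apply_le_inv_pow e Ls he hgen hcard hA hs hP h4 hc₀ hcoer m N hLN l hl hkm x y
    rwa [one_div_pow, ← div_eq_mul_one_div] at *
  have hfar := fun (N : ℕ) (hN : (Ls 0 : ℝ) < (2 : ℝ) ^ N) =>
    abs_rowDiffs_frdPiecePow_far_temporal_le e Ls hL he hgen hcard hL01 hLM hA hs hP h4 hc₀ hcoer N hN l htemp hk2 hkm x y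
  exact abs_rowDiffs_pinv_le_core hA hs hP h4 h0 ha₀ hmin hm hl1 x y (by positivity) (by positivity)
    (by positivity : (0 : ℝ) ≤ 1 / (Ls 0 : ℝ) ^ 2) (by omega : 1 ≤ k - 1) (by omega : 1 ≤ k + 1) hvan h3D hfar

end Decay

end Literature.Analysis.Matrix

end
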